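import Summits.CriticalPhenomena.PercolationContinuityZ3.Theorems.Transplant.SiteThetaContinuousGraph
import Summits.CriticalPhenomena.PercolationContinuityZ3.Theorems.Transplant.SiteUniquenessRows
import Summits.CriticalPhenomena.PercolationContinuityZ3.Theorems.Transplant.LineGraphGrowth
import Summits.CriticalPhenomena.PercolationContinuityZ3.Theorems.Transplant.PyrochloreLattice
import Summits.CriticalPhenomena.PercolationContinuityZ3.Theorems.Transplant.KagomeSiteCritical
import Summits.CriticalPhenomena.PercolationContinuityZ3.Theorems.Transplant.LineGraphSiteContinuity
import Literature.Probability.Percolation.SiteBoundedDegreeCriticalProb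
import HarnessLib

/-!
# The continuity column for the SITE rows: `p ↦ θ^{site}(v, p)` ∈ C[0,1] on the pyrochlore lattice, the kagome lattice, the `(3,12²)`
# tiling, and the covering lattice of `ℤ^d`

builds on p205010 (kernel theorem, internal audit signed; external expert review pending) — through the `θ^{site}(p_c^{site}) = 0` theorems of
the rows (gen 13/14: covering-graph / edge-net devices over the bond rows).  Lane `prim-bschramm`, seat `prim-bschramm-p2` gen 17 (class
C1b); helper file (`--supports stmt-CriticalPhenomena-4575 --as helper`).

The van den Berg–Keane criterion for SITE percolation on a general graph (`SiteThetaContGraph.continuous_siteTheta_iff_of_unique`, this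
generation) needs: `p_c^{site} > 0` (bounded degree, `siteCriticalProb_pos_of_degree_le`), a.s. uniqueness of the infinite open site cluster
(`SiteUniquenessRows` / `LineGraphGrowth`, this generation: amenability + site Burton–Keane), and `θ^{site}_v(p_c^{site}(G,v)) = 0` (the rows).
* **`continuous_siteTheta_pyrochlore`**, **`continuous_siteTheta_kagome`**, **`continuous_siteTheta_threeTwelve`**,
  **`continuous_siteTheta_zdLineGraph (hd : 2 ≤ d)`** — every vertex.
[cite: VandenBergKeane1984, main theorem] [cite: GrimmettPercolation1999, §8.3 Thm (8.8)] [cite: BenjaminiSchramm1996, Conj. 4] -/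

noncomputable section

namespace Summit.CriticalPhenomena.PercolationContinuityZ3.Theorems.Transplant

namespace SiteThetaContRows

open MeasureTheory Literature.Probability.Percolation Literature.Probability.LatticeModels SimpleGraph Filter
open Literature.Barriers.CriticalPhenomena Literature.MathematicalPhysics.QuantumLattice
open SiteThetaContGraph SiteUniqRows LineGraphGrowth Subdiv
open scoped Classical Topology

/-- **`p ↦ θ^{site}_{pyrochlore}(m, p)` is continuous on `[0, 1]` at every site of the pyrochlore lattice.**
[cite: VandenBergKeane1984, main theorem] [cite: BenjaminiSchramm1996, Conj. 4] -/
theorem continuous_siteTheta_pyrochlore (m : pyrochloreSite) : Continuous fun p : unitInterval => siteTheta pyrochloreGraph m p := by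
  obtain ⟨D, hD⟩ := pyrochlore_isQuasiTransitive.exists_degree_le
  exact (continuous_siteTheta_iff_of_unique pyrochloreGraph m (siteCriticalProb_pos_of_degree_le pyrochloreGraph hD m)
    (fun p _ => pyrochlore_site_uniqueness p)).2 (pyrochlore_siteCriticalContinuity m)

/-- **`p ↦ θ^{site}_{kagome}(v, p)` is continuous on `[0, 1]` at every site of the kagome lattice** (across `p_c^{site} = 1 - 2 sin(π/18)`).
[cite: VandenBergKeane1984, main theorem] [cite: BenjaminiSchramm1996, Conj. 4] -/
theorem continuous_siteTheta_kagome (v : KagomeVertex) : Continuous fun p : unitInterval => siteTheta kagomeGraph v p := by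
  obtain ⟨D, hD⟩ := kagome_isQuasiTransitive.exists_degree_le
  exact (continuous_siteTheta_iff_of_unique kagomeGraph v (siteCriticalProb_pos_of_degree_le kagomeGraph hD v)
    (fun p _ => kagome_site_uniqueness p)).2 (kagome_siteCriticalContinuity v)

/-- **`p ↦ θ^{site}(e, p)` is continuous on `[0, 1]` at every site of the `(3,12²)` tiling `L(honeycomb^∘)`** (across
`p_c^{site} = √(1 - 2 sin(π/18))`). [cite: VandenBergKeane1984, main theorem] [cite: BenjaminiSchramm1996, Conj. 4] -/
theorem continuous_siteTheta_threeTwelve (e : (subdiv hexGraph).edgeSet) :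
    Continuous fun p : unitInterval => siteTheta (subdiv hexGraph).lineGraph e p := by
  haveI : (subdiv hexGraph).LocallyFinite := nonempty_subdiv_locallyFinite.some
  haveI : (subdiv hexGraph).lineGraph.LocallyFinite := nonempty_lineGraph_locallyFinite.some
  obtain ⟨D, hD⟩ := threeTwelve_site_conj4_hypotheses.2.1.exists_degree_le
  exact (continuous_siteTheta_iff_of_unique (subdiv hexGraph).lineGraph e
    (siteCriticalProb_pos_of_degree_le (subdiv hexGraph).lineGraph hD e) (fun p _ => threeTwelve_site_uniqueness p)).2
    (threeTwelve_siteCriticalContinuity e)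

/-- **`p ↦ θ^{site}(e, p)` is continuous on `[0, 1]` at every site of the covering lattice of `ℤ^d`, every `d ≥ 2`** (`d = 2`: Kesten's
`G₁`; `d ≥ 3` builds on p205010 (kernel theorem, internal audit signed; external expert review pending) through the bond row of `ℤ^d`).
[cite: VandenBergKeane1984, main theorem] [cite: BenjaminiSchramm1996, Conj. 4] -/
theorem continuous_siteTheta_zdLineGraph (d : ℕ) [NeZero d] (hd : 2 ≤ d) (e : (zdGraph d).edgeSet) :
    Continuous fun p : unitInterval => siteTheta (zdGraph d).lineGraph e p := by
  haveI : (zdGraph d).lineGraph.LocallyFinite := nonempty_lineGraph_locallyFinite.some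
  obtain ⟨D, hD⟩ := (lineGraph_isQuasiTransitive (zdGraph_isQuasiTransitive d)).exists_degree_le
  exact (continuous_siteTheta_iff_of_unique (zdGraph d).lineGraph e (siteCriticalProb_pos_of_degree_le (zdGraph d).lineGraph hD e)
    (fun p _ => zdLineGraph_site_uniqueness d p)).2 (zdLineGraph_siteCriticalContinuity d hd e)

end SiteThetaContRows

end Summit.CriticalPhenomena.PercolationContinuityZ3.Theorems.Transplant

end
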